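import Mathlib
import Literature.MathematicalPhysics.QuantumFieldTheory.Balaban1983to89.B5FiberQQ

/-!
# B5 (1.31)/(1.69): the term `Δ` — the position-space `Δ = Σ_ν ∇_ν^*∇_ν` of (1.21)/(1.69) IS,
# fiberwise in momentum space, the multiplier «Δ(p) = Σ_μ |∂_μ(p)|²» of (1.31), i.e. the `Δ`
# of the fiber algebra of `B5Prop11Inverse` (pass 5) at B5's data

Source: T. Bałaban, *Propagators and renormalization transformations for lattice gauge
theories. I*, Commun. Math. Phys. 95 (1984) 17–40 (`Balaban1984PropagatorsI`, "B5"), renders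
`b2b-balaban-ref1/pages/1984-cmp95-propagators-rt-I/…-pNNN-x2.png` (PDF page = journal page − 16),
read as images.

## What the paper prints (verbatim)

* p. 23 [PDF 7], (1.31): «Δ(p) = Σ_{μ=1}^{d} |∂_μ(p)|², ∂_μ(p) = (e^{iηp_μ} − 1)/η, u_k(p) = …».
* p. 21 [PDF 5], after (1.21): «Δ is η-lattice Laplace operator for scalar functions»; p. 29
  [PDF 13], (1.69): «⟨A, Δ_a A⟩ = ⟨A, ∂*∂A⟩ + ⟨A, ∂R∂*A⟩ + a⟨A, Q*QA⟩ = ⟨A, ΔA⟩ − ⟨A, ∂P∂*A⟩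
  + a⟨A, Q*QA⟩, Δ = ∂*∂ + ∂∂*, R = I − P,».
* p. 31 [PDF 15], (1.83)/(1.84): the denominators «Δ(p′+l)», «Δ(p′+l″)».

## What is typed and certified here (kernel-checked, zero sorry)

With pass 4's componentwise unitary DFT `dftV` and forward differences `fdiff N c ν` (symbols
`fsym`, `dftV_mul_fdiff`), pass 7's `LapV N c = Σ_ν (∇_ν)ᴴ∇_ν` (= pass 6's `Lap n M` on `T_η`, and
= B5's `∂*∂ + ∂∂*` componentwise by `B5Action121`), pass 3's symbols `dSym` and pass 13's
`fiberAt`: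
* `dftV_mul_fdiffH_mul_fdiff`, `dftV_mul_LapV` — `U (Σ_ν ∇_ν^*∇_ν) = diag(Σ_ν |∂_ν(p)|²) U` for any
  torus and lattice constant;
* `dft_Lap` — ON B5's DATA: `(Δ A)^_κ(p′+l) = (Σ_ν |∂_ν(p′+l)|²) · Â_κ(p′+l)` with
  `∂_ν(p′+l) = dSym n k (sOf q) ν` — the printed «Δ(p) = Σ_μ |∂_μ(p)|²» as the symbol of the
  position-space `Δ`, for every `p = p′ + l`;
* `fiberAt_Δ`, `dft_Lap_fiber` — THE IDENTIFICATION with pass 5: for `q ≠ 0` that multiplier is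
  `(fiberAt q).Δ l = DeltaXir n 0 (shiftr n k (sOf q))`, the `Δ(p′+l)` of the abstract fiber algebra
  (1.73) ⟹ (1.83) certified in `B5Prop11Inverse`.
With `B5FiberQQ.fiber_QstarQ` this identifies two of the three terms of `Δ_a = Δ − ∂P∂* + aQ*Q`
((1.69)) between position space and pass 5's fibers.

## What is NOT certified here

The `∂P∂*` term ((1.70): `P = Δ⁻¹Q′*(Q′Δ⁻²Q′*)⁻¹Q′Δ⁻¹` on the complement of constants); hence
`calDa` of pass 5 as a whole; fields complex.
-/

open scoped BigOperators Matrix ComplexConjugate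
open Finset Complex

namespace Literature.MathematicalPhysics.QuantumFieldTheory.Balaban1983to89.B5FiberDelta

open Literature.MathematicalPhysics.QuantumFieldTheory.Balaban1983to89.B4Strip
open Literature.MathematicalPhysics.QuantumFieldTheory.Balaban1983to89.B5Prop11Fiber
open Literature.MathematicalPhysics.QuantumFieldTheory.Balaban1983to89.B5Prop11Plancherel
open Literature.MathematicalPhysics.QuantumFieldTheory.Balaban1983to89.B5Prop11Lower
open Literature.MathematicalPhysics.QuantumFieldTheory.Balaban1983to89.B5Action121
open Literature.MathematicalPhysics.QuantumFieldTheory.Balaban1983to89.B5Block118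
open Literature.MathematicalPhysics.QuantumFieldTheory.Balaban1983to89.B5FiberQQ

noncomputable section

section Generic

variable {d : ℕ} (N : Fin d → ℕ) [hN : ∀ μ, NeZero (N μ)]

/-- `U ∇_ν^*∇_ν = diag(\overline{∂_ν(p)} ∂_ν(p)) U` (from pass 4's `U∇_ν = diag(∂_ν)U` and unitarity).
[folklore] -/
theorem dftV_mul_fdiffH_mul_fdiff (c : ℂ) (ν : Fin d) :
    dftV N * ((fdiff N c ν)ᴴ * fdiff N c ν)
      = (Matrix.diagonal (fsym N c ν))ᴴ * Matrix.diagonal (fsym N c ν) * dftV N := by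
  have h := dftV_mul_fdiff N c ν
  have hU1 : dftV N * (dftV N)ᴴ = 1 := by
    have h1 := Matrix.mem_unitaryGroup_iff.mp (dftV_mem_unitaryGroup N)
    rwa [Matrix.star_eq_conjTranspose] at h1
  have hU2 : (dftV N)ᴴ * dftV N = 1 := by
    have h2 := Matrix.mem_unitaryGroup_iff'.mp (dftV_mem_unitaryGroup N)
    rwa [Matrix.star_eq_conjTranspose] at h2
  have hH : (fdiff N c ν)ᴴ = (dftV N)ᴴ * (Matrix.diagonal (fsym N c ν))ᴴ * dftV N := by
    have h2 := congrArg Matrix.conjTranspose h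
    rw [Matrix.conjTranspose_mul, Matrix.conjTranspose_mul] at h2
    calc (fdiff N c ν)ᴴ = (fdiff N c ν)ᴴ * ((dftV N)ᴴ * dftV N) := by rw [hU2, Matrix.mul_one]
      _ = (dftV N)ᴴ * (Matrix.diagonal (fsym N c ν))ᴴ * dftV N := by
          rw [← Matrix.mul_assoc, h2]
  calc dftV N * ((fdiff N c ν)ᴴ * fdiff N c ν)
      = dftV N * (dftV N)ᴴ * (Matrix.diagonal (fsym N c ν))ᴴ * (dftV N * fdiff N c ν) := by
        rw [hH]
        simp only [Matrix.mul_assoc]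
    _ = (Matrix.diagonal (fsym N c ν))ᴴ * Matrix.diagonal (fsym N c ν) * dftV N := by
        rw [hU1, Matrix.one_mul, h, Matrix.mul_assoc]

/-- `U (Σ_ν ∇_ν^*∇_ν) = diag(Σ_ν |∂_ν(p)|²) U`: the componentwise Laplace operator is the Fourier
multiplier «Δ(p) = Σ_μ |∂_μ(p)|²». [cite: Balaban1984PropagatorsI, (1.31) p.23] -/
theorem dftV_mul_LapV (c : ℂ) :
    dftV N * LapV N c
      = Matrix.diagonal (fun i => ∑ ν, conj (fsym N c ν i) * fsym N c ν i) * dftV N := by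
  unfold LapV
  rw [Finset.mul_sum]
  simp_rw [dftV_mul_fdiffH_mul_fdiff]
  rw [← Finset.sum_mul]
  congr 1
  ext i j
  rw [Matrix.sum_apply]
  simp_rw [Matrix.diagonal_conjTranspose, Matrix.diagonal_mul_diagonal]
  by_cases hij : i = j
  · subst hij
    simp only [Matrix.diagonal_apply_eq, Pi.star_apply, Complex.star_def]
  · simp only [Matrix.diagonal_apply_ne _ hij, Finset.sum_const_zero]

end Generic

variable {d : ℕ} (n : ℕ) [NeZero n] (M : Fin d → ℕ) [hM : ∀ μ, NeZero (M μ)]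

/-- ON B5's DATA: `(Δ A)^_κ(p′+l) = (Σ_ν |∂_ν(p′+l)|²)·Â_κ(p′+l)`, `∂_ν(p′+l) = dSym n k (sOf q) ν` —
«Δ(p) = Σ_μ |∂_μ(p)|²» (1.31) is the symbol of the position-space `Δ` of (1.21)/(1.69), for every
`p = p′ + l` (incl. `p′ = 0`). [cite: Balaban1984PropagatorsI, (1.31) p.23, (1.69) p.29] -/
theorem dft_Lap (A : Tor (fine n M) × Fin d → ℂ) (k : Fin d → Fin n) (q : Tor M) (κ : Fin d) :
    (dftV (fine n M) *ᵥ (Lap n M *ᵥ A)) (pOf n M (k, q), κ)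
      = ((∑ ν, ‖dSym n k (sOf M q) ν‖ ^ 2 : ℝ) : ℂ) * (dftV (fine n M) *ᵥ A) (pOf n M (k, q), κ) := by
  rw [Lap_eq_LapV, Matrix.mulVec_mulVec, dftV_mul_LapV, ← Matrix.mulVec_mulVec,
    Matrix.mulVec_diagonal]
  congr 1
  rw [← emb_eq]
  simp_rw [fsym_emb]
  push_cast
  refine Finset.sum_congr rfl fun ν _ => ?_
  rw [← Complex.ofReal_pow, Complex.sq_norm, Complex.normSq_eq_conj_mul_self]

/-- `Δ` of the fiber at `q` is `Δ(p′+l) = DeltaXir n 0 (shiftr n l (sOf q))`. [folklore] -/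
theorem fiberAt_Δ (hn : 1 ≤ n) (a : ℝ) (ha : 0 < a) (q : Tor M) (hq : q ≠ 0) (k : Fin d → Fin n) :
    (fiberAt n M hn a ha q hq).Δ k = DeltaXir n 0 (shiftr n k (sOf M q)) := rfl

/-- THE IDENTIFICATION (q ≠ 0): `(Δ A)^_κ(p′+l) = Δ(p′+l)·Â_κ(p′+l)` with `Δ(p′+l) = (fiberAt q).Δ l`,
the `Δ` of pass 5's fiber algebra (1.73) ⟹ (1.83) — the `Δ` of (1.69) in position space and in the
fibers agree. [cite: Balaban1984PropagatorsI, (1.69) p.29, (1.83) p.31] -/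
theorem dft_Lap_fiber (hn : 1 ≤ n) (a : ℝ) (ha : 0 < a) (A : Tor (fine n M) × Fin d → ℂ)
    (k : Fin d → Fin n) {q : Tor M} (hq : q ≠ 0) (κ : Fin d) :
    (dftV (fine n M) *ᵥ (Lap n M *ᵥ A)) (pOf n M (k, q), κ)
      = (((fiberAt n M hn a ha q hq).Δ k : ℝ) : ℂ) * (dftV (fine n M) *ᵥ A) (pOf n M (k, q), κ) := by
  rw [dft_Lap, fiberAt_Δ, Delta_eq]

end

end Literature.MathematicalPhysics.QuantumFieldTheory.Balaban1983to89.B5FiberDelta
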